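import Summits.BirchSwinnertonDyer.BirchSwinnertonDyer.Theorems.KatoDescentPotSupersingularReducibleLayerZeroDoors
import Summits.BirchSwinnertonDyer.BirchSwinnertonDyer.Theorems.KatoDescentPotSupersingularReducibleFineSelmerImaginaryQuadraticThree
import Literature.NumberTheory.NumberFields.LeopoldtReflectionIsotypicVanishing
import Literature.NumberTheory.EllipticCurves.DivisionFieldReducibleBorelDeterminant
import HarnessLib

/-!
# THE REFLECTION CORE of crux M: on a reducible row over `ℚ` with `χ₁` ODD, the layer-zero eigen-test of the EVEN character field is a
# consequence of an EIGENCLASS test on the ODD character field — LEOPOLDT'S REFLECTION THEOREM (isotypic Spiegelungssatz,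
# `Literature/…/LeopoldtReflectionIsotypic*.lean`) inside the CM field `L = ℚ(χ₁, χ₂) ∋ ζ_p`
# (route-free helper for crux M = stmt-BirchSwinnertonDyer-19196 `ReducibleKatoMember`, K9 / K8-t′; seat `bsd-potss-rkm` g41; consumed by
# `…ReducibleReflectionDoors.lean`)

WHY.  g39/g40's per-row doors for statement (A) on a reducible row (`0 → C → W[p] → W[p]/C → 0`, `χ₁χ₂ = ω`) need a layer-zero EIGEN-TEST on
EACH character field `ℚ(χ₁)`, `ℚ(χ₂)`; on the ODD field it is one integer (`p ∤ h⁻`, g40) or a certified eigenclass computation, on the EVEN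
(real) field it needed the class group of a real field of degree up to `p − 1` (GRH for degree 16 at `p = 17`).  By the reflection theorem
(Washington Thm. 10.9 «`p-rank ε_even A ≤ p-rank ε_odd A`», isotypic form PROVED: `IsCMField.eigenHom_eq_zero_of_reflection_of_eigenClass_test`)
a `χ_even`-eigenfunctional on `Cl(ℚ(χ_even))` pulls back to `L`, reflects into a `χ_odd = ωχ_even⁻¹`-eigenclass of `Cl(L)[p]` (`det ρ̄ = ω` on
`ζ = e_p(P, P₂)`: `DivisionFieldReducibleBorelDeterminant`) and descends to a `χ₁`-eigenclass of `Cl(ℚ(χ_odd))[p]` — so an eigenclass test on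
the ODD side discharges the EVEN side's eigen-test.
* §1 bookkeeping on a stable line (scalars of `τ` on `C` / on `W[p]/C` depend only on `τ|_L`; `n•P = m•P ⟹ n ≡ m`; restriction of
  automorphisms to subfields of an abelian extension — by hand, avoiding `restrictNormal` at base `ℚ`).
* §2 `eigenTest_even₂_of_eigenClass_test_odd₁` — THE CORE: `χ₁` odd (a `τ₀ ∈ Γ_ℚ` inducing a complex conjugation of `L` acts on `P` by
  `p − 1`), `χ₂ ≠ 1`, a subfield `K₁ ⊆ L` whose fixator fixes `P` with an EIGENCLASS TEST (`x ∈ Cl(K₁)[p]` with `σ • x = x^a` whenever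
  `τ ↦ σ`, `τP = aP` ⟹ `x = 1`), and a subfield `K₂` whose fixator fixes `P₂ mod C`: THEN the layer-zero eigen-test holds on `K₂`.
HONEST FRAMING.  Theorems only; route-free; closes nothing; crux M stays cite-level over {Fine, H2X⁺, modularity} ⊕ `H_IC`; no class number is
computed in Lean; BSD is proved for no curve.  References: [Washington1997] §10.2 Thm. 10.9/10.11; [Lang1990] Ch. 13 §2 Thm. 2.1;
[CoatesSujatha2005] Thm. 3.4, Cor. 3.6; [DeoRaySujatha2023] §3 Thm. 3.8; [Serre1972] §4; [SilvermanAEC2009] III.8.1.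
-/

-- the summit and its single problem are both named `BirchSwinnertonDyer` (registry layout D-0017)
set_option linter.dupNamespace false
set_option autoImplicit false

noncomputable section

open scoped Classical Pointwise NumberField nonZeroDivisors
open Field NumberField IsDedekindDomain IntermediateField WeierstrassCurve
open Literature.NumberTheory.EllipticCurves Literature.NumberTheory.EllipticCurves.GreenbergSelmer
open Literature.NumberTheory.GaloisRepresentations Literature.NumberTheory.IwasawaTheory Literature.NumberTheory.NumberFields
open Literature.NumberTheory.EllipticCurves.FineSelmerReducibleIsotypic Literature.NumberTheory.EllipticCurves.CoatesSujatha2005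
open Literature.NumberTheory.EllipticCurves.ZpExtension
open Summit.BirchSwinnertonDyer.BirchSwinnertonDyer.Theorems
open Summit.BirchSwinnertonDyer.BirchSwinnertonDyer.Theorems.ReducibleFineSelmerCharacterFields
open Summit.BirchSwinnertonDyer.BirchSwinnertonDyer.Theorems.ReducibleFineSelmerLayerZero

namespace Summit.BirchSwinnertonDyer.BirchSwinnertonDyer.Theorems.ReducibleFineSelmerReflection

/-! ## §1 Bookkeeping on a stable line: scalars of `τ` on `C` and on `W[p]/C` depend only on `τ|_{ℚ(χ₁,χ₂)}` -/

section Bookkeeping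

variable {K : Type} [Field K] [NumberField K] (W : WeierstrassCurve K) [W.IsElliptic] {p : ℕ} [Fact p.Prime]

/-- **Two elements of `Γ_K` with the same restriction to `K(χ₁,χ₂)` act identically on `C` and identically modulo `C` on `W[p]`**
(their quotient lies in the Borel kernel `ker χ₁ ∩ ker χ₂ = Gal(K̄/K(χ₁,χ₂))`). [cite: Wuthrich2014, Lemma 14 (p. 396)] [cite: Serre1972, §4] -/
theorem smul_eq_smul_of_absRestrictNormalHom_eq (C : AddSubgroup (W.geomTorsion (p : ℤ)))
    (hC : ∀ (σ : absoluteGaloisGroup K) (x : W.geomTorsion (p : ℤ)), x ∈ C → σ • x ∈ C)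
    (τ τ' : absoluteGaloisGroup K)
    (h : haveI : NeZero p := ⟨(Fact.out : p.Prime).ne_zero⟩
      haveI := isGalois_borelField (W := W) hC
      absRestrictNormalHom (W.borelField C) τ = absRestrictNormalHom (W.borelField C) τ') :
    (∀ x : W.geomTorsion (p : ℤ), x ∈ C → τ • x = τ' • x) ∧ ∀ y : W.geomTorsion (p : ℤ), τ • y - τ' • y ∈ C := by
  haveI : NeZero p := ⟨(Fact.out : p.Prime).ne_zero⟩
  haveI := isGalois_borelField (W := W) hC
  haveI : FiniteDimensional K (W.borelField C) := finiteDimensional_borelField C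
  have hNopen : IsOpen (W.borelKernel C : Set (absoluteGaloisGroup K)) := isOpen_borelKernel C
  have hker : absRestrictNormalHom (W.borelField C) (τ'⁻¹ * τ) = 1 := by rw [map_mul, map_inv, h, inv_mul_cancel]
  have hN : τ'⁻¹ * τ ∈ W.borelKernel C := by
    rw [absRestrictNormalHom_eq_one_iff, borelField_def] at hker
    exact (SetLike.ext_iff.mp (fixingSubgroup_fixedField_of_isOpen _ hNopen) _).mp hker
  obtain ⟨hNC, hNV⟩ := mem_borelKernel_iff.mp hN
  refine ⟨fun x hx => ?_, fun y => ?_⟩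
  · have h1 := hNC x hx
    rw [mul_smul] at h1
    calc τ • x = τ' • (τ'⁻¹ • (τ • x)) := by rw [smul_inv_smul]
      _ = τ' • x := by rw [h1]
  · have h1 := hNV y
    rw [mul_smul] at h1
    have h2 : τ • y - τ' • y = τ' • (τ'⁻¹ • (τ • y) - y) := by rw [smul_sub, smul_inv_smul]
    rw [h2]
    exact hC τ' _ h1

omit [NumberField K] [W.IsElliptic] in
/-- `n • P = m • P ⟹ n ≡ m (mod p)` for a non-zero `p`-torsion point `P` (`P` has additive order `p`). [folklore] -/
theorem modEq_of_nsmul_eq_nsmul {P : W.geomTorsion (p : ℤ)} (hP0 : P ≠ 0) {n m : ℕ} (h : n • P = m • P) :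
    n ≡ m [MOD p] := by
  have hpP : p • P = 0 := Subtype.ext (by
    rw [AddSubmonoidClass.coe_nsmul, ZeroMemClass.coe_zero]; exact AddSubgroup.torsionBy.nsmul_iff.mp P.2)
  have hord : addOrderOf P = p := addOrderOf_eq_prime hpP hP0
  rw [nsmul_eq_nsmul_iff_modEq, hord] at h
  exact h

omit [NumberField K] [W.IsElliptic] in
/-- `n • P₂ − m • P₂ ∈ C ⟹ n ≡ m (mod p)` for `P₂ ∉ C` (`W[p]/C` has order `p`; a difference prime to `p` would put `P₂` in `C`).
[folklore] -/
theorem modEq_of_nsmul_sub_nsmul_mem (C : AddSubgroup (W.geomTorsion (p : ℤ))) {P₂ : W.geomTorsion (p : ℤ)}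
    (hP₂ : P₂ ∉ C) {n m : ℕ} (h : n • P₂ - m • P₂ ∈ C) : n ≡ m [MOD p] := by
  have hp : p.Prime := Fact.out
  have hpP : (p : ℤ) • P₂ = 0 := Subtype.ext (by
    rw [AddSubgroupClass.coe_zsmul, ZeroMemClass.coe_zero]; exact P₂.2)
  have hz : ((n : ℤ) - (m : ℤ)) • P₂ ∈ C := by
    rw [sub_smul, natCast_zsmul, natCast_zsmul]; exact h
  by_contra hne
  apply hP₂
  have hcop : IsCoprime ((n : ℤ) - (m : ℤ)) (p : ℤ) := by
    refine (Int.isCoprime_iff_gcd_eq_one.mpr ?_)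
    rw [Int.gcd_comm]
    have h1 : ¬ (p : ℤ) ∣ (n : ℤ) - (m : ℤ) := fun hd => hne (Nat.modEq_iff_dvd.mpr hd).symm
    have hg : Int.gcd (p : ℤ) ((n : ℤ) - (m : ℤ)) ∣ p := by exact_mod_cast Int.gcd_dvd_left (p : ℤ) ((n : ℤ) - (m : ℤ))
    rcases (Nat.dvd_prime hp).mp hg with hg1 | hgp
    · exact hg1
    · exact absurd (hgp ▸ Int.gcd_dvd_right (p : ℤ) ((n : ℤ) - (m : ℤ))) h1
  obtain ⟨u, v, huv⟩ := hcop
  have hP : P₂ = u • (((n : ℤ) - (m : ℤ)) • P₂) + v • ((p : ℤ) • P₂) := by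
    rw [smul_smul, smul_smul, ← add_smul, huv, one_smul]
  rw [hP, hpP, smul_zero, add_zero]
  exact C.zsmul_mem hz u

omit [NumberField K] [W.IsElliptic] [Fact p.Prime] in
/-- `Γ_K` commutes with natural multiples on `E[p]`. [folklore] -/
theorem smul_nsmul_geomTorsion (σ : absoluteGaloisGroup K) (k : ℕ) (x : W.geomTorsion (p : ℤ)) :
    σ • (k • x) = k • (σ • x) :=
  map_nsmul (DistribSMul.toAddMonoidHom (W.geomTorsion (p : ℤ)) σ) k x

omit [NumberField K] [W.IsElliptic] in
/-- An integer scalar on a `p`-torsion point is a natural scalar `< p`. [folklore] -/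
theorem exists_nsmul_eq_zsmul (x : W.geomTorsion (p : ℤ)) (a : ℤ) : ∃ n : ℕ, (n : ℤ) • x = a • x := by
  have hp : p.Prime := Fact.out
  have hpP : (p : ℤ) • x = 0 := Subtype.ext (by
    rw [AddSubgroupClass.coe_zsmul, ZeroMemClass.coe_zero]; exact x.2)
  refine ⟨(a % p).toNat, ?_⟩
  rw [Int.toNat_of_nonneg (Int.emod_nonneg a (by exact_mod_cast hp.ne_zero))]
  conv_rhs => rw [← Int.emod_add_mul_ediv a p]
  rw [add_smul, mul_comm, mul_smul, hpP, smul_zero, add_zero]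

omit [NumberField K] in
/-- Restriction `Γ_K → Gal(E/K)` is onto for `E ⊆ K̄` normal over `K`. [folklore] -/
theorem absRestrictNormalHom_surjective₅ (E : IntermediateField K (AlgebraicClosure K)) [Normal K E] :
    Function.Surjective (absRestrictNormalHom E) := fun g => by
  obtain ⟨σ, hσ⟩ := AlgEquiv.restrictNormalHom_surjective (AlgebraicClosure K) g
  exact ⟨(Field.absoluteGaloisGroup.toAlgEquiv K).symm σ, hσ⟩

omit [NumberField K] in
/-- **Restriction of an automorphism to a subfield it stabilises** (with its inverse): a `K`-automorphism `σE` of `E` with `σE y = σ y`.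
[folklore] -/
theorem exists_algEquiv_restrict_of_forall_mem {L : Type} [Field L] [Algebra K L] (E : IntermediateField K L) (σ : L ≃ₐ[K] L)
    (hσ : ∀ y : L, y ∈ E → σ y ∈ E) (hσ' : ∀ y : L, y ∈ E → σ.symm y ∈ E) :
    ∃ σE : ↥E ≃ₐ[K] ↥E, ∀ y : ↥E, ((σE y : ↥E) : L) = σ y :=
  ⟨{ toFun := fun y => ⟨σ y, hσ y y.2⟩,
     invFun := fun y => ⟨σ.symm y, hσ' y y.2⟩,
     left_inv := fun y => Subtype.ext (σ.symm_apply_apply y),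
     right_inv := fun y => Subtype.ext (σ.apply_symm_apply y),
     map_mul' := fun x y => Subtype.ext (by
       change σ ((x : L) * y) = σ x * σ y
       exact map_mul σ _ _),
     map_add' := fun x y => Subtype.ext (by
       change σ ((x : L) + y) = σ x + σ y
       exact map_add σ _ _),
     commutes' := fun k => Subtype.ext (σ.commutes k) }, fun y => rfl⟩

omit [NumberField K] in
/-- **In an abelian extension every intermediate field is stable under the Galois group** (`E = L^{Gal(L/E)}` and the group is
commutative). [folklore] -/
theorem algEquiv_mem_of_isMulCommutative {L : Type} [Field L] [Algebra K L] [FiniteDimensional K L] [IsGalois K L]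
    (hcomm : ∀ g σ : L ≃ₐ[K] L, g * σ = σ * g) (E : IntermediateField K L) (σ : L ≃ₐ[K] L) (y : L) (hy : y ∈ E) : σ y ∈ E := by
  rw [← IsGalois.fixedField_fixingSubgroup E] at hy ⊢
  rw [IntermediateField.mem_fixedField_iff] at hy ⊢
  intro g hg
  rw [← AlgEquiv.mul_apply, hcomm g σ, AlgEquiv.mul_apply, hy g hg]

end Bookkeeping

/-! ## §2 THE REFLECTION CORE over `ℚ` -/

section Door

variable (W : WeierstrassCurve ℚ) [W.IsElliptic] {p : ℕ} [Fact p.Prime]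

set_option maxHeartbeats 800000 in -- one long assembly proof (many `choose`s over `Gal(L/ℚ)`); splitting it would duplicate the set-up
/-- **THE REFLECTION CORE: the layer-zero eigen-test on the EVEN side (`K₂`, `χ₂`) from an EIGENCLASS TEST on the ODD side (`K₁`, `χ₁`).**
Data: `C` a stable line of `W[p]` (`p` odd), `P ∈ C ∖ 0`, `P₂ ∉ C`; `τ₀ ∈ Γ_ℚ` inducing a complex conjugation on `L = ℚ(χ₁,χ₂)` (under some
complex embedding of `L`) with `τ₀•P = (p−1)•P` (`χ₁` ODD); `χ₂ ≠ 1`; subfields `K₁, K₂ ⊆ L` (number fields) whose fixators fix `P`, resp.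
`P₂ mod C` (e.g. the canonical `ℚ(P)`, `ℚ(P′)`); and the EIGENCLASS TEST on `K₁`: every `x ∈ Cl(K₁)` with `x^p = 1` and `σ • x = x^a`
whenever `τ ∈ Γ_ℚ` restricts to `σ` on `K₁` and `τP = aP` is trivial.  THEN every additive `μ : Cl(K₂) → ℤ/p` which is an eigenfunctional
for the compatible `(τ, σ, a)` (`τ ↦ σ` on `K₂`, `τP₂ ≡ aP₂ mod C`) vanishes — g39's layer-zero eigen-test on side 2.  Proof: `L` is CM
(abelian over `ℚ`, `ζ_p = e_p(P,P₂) ∈ L`); exponent systems `ψ = χ₂`, `ω = χ₁χ₂` on `Gal(L/ℚ)` (`σζ = ζ^{ω σ}` is `det ρ̄ = ω`); `μ` pulls back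
along `N_{L/K₂}`, the isotypic reflection theorem (`IsCMField.eigenHom_eq_zero_of_reflection_of_eigenClass_test`) produces a
`ωψ⁻¹ = χ₁`-eigenclass which descends to `Cl(K₁)[p]` and is killed by the eigenclass test.
[cite: Washington1997, §10.2, Thm. 10.9 and Thm. 10.11] [cite: Lang1990, Ch. 13 §2, Thm. 2.1] [cite: Serre1972, §4 (Borel image: χ₁χ₂ = det = χ)]
[cite: DeoRaySujatha2023, §3 Thm. 3.8 (c2)] -/
theorem eigenTest_even₂_of_eigenClass_test_odd₁ (hp : p ≠ 2)
    (C : AddSubgroup (W.geomTorsion (p : ℤ)))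
    (hC : ∀ (σ : absoluteGaloisGroup ℚ) (x : W.geomTorsion (p : ℤ)), x ∈ C → σ • x ∈ C)
    (h1 : C ≠ ⊥) (h2 : C ≠ ⊤)
    (P : W.geomTorsion (p : ℤ)) (hPC : P ∈ C) (hP0 : P ≠ 0)
    (P₂ : W.geomTorsion (p : ℤ)) (hP₂ : P₂ ∉ C)
    (K₁ : haveI : NeZero p := ⟨(Fact.out : p.Prime).ne_zero⟩
      haveI := isGalois_borelField (W := W) hC
      IntermediateField ℚ (W.borelField C))
    (hK₁ : NumberField K₁)
    (hK₁P : haveI : NeZero p := ⟨(Fact.out : p.Prime).ne_zero⟩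
      haveI := isGalois_borelField (W := W) hC
      ∀ τ : absoluteGaloisGroup ℚ,
        (∀ x : K₁, absRestrictNormalHom (W.borelField C) τ (x : W.borelField C) = x) → τ • P = P)
    (K₂ : haveI : NeZero p := ⟨(Fact.out : p.Prime).ne_zero⟩
      haveI := isGalois_borelField (W := W) hC
      IntermediateField ℚ (W.borelField C))
    (hK₂ : NumberField K₂)
    (τ₀ : absoluteGaloisGroup ℚ)
    (hτ₀ : haveI : NeZero p := ⟨(Fact.out : p.Prime).ne_zero⟩
      haveI := isGalois_borelField (W := W) hC
      ∃ φ : ↥(W.borelField C) →+* ℂ, ∀ x : ↥(W.borelField C),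
        φ (absRestrictNormalHom (W.borelField C) τ₀ x) = starRingEnd ℂ (φ x))
    (hτP : τ₀ • P = (p - 1) • P)
    (hne₂ : ∃ τ : absoluteGaloisGroup ℚ, τ • P₂ - P₂ ∉ C)
    (hkill₁ : haveI : NeZero p := ⟨(Fact.out : p.Prime).ne_zero⟩
      haveI := isGalois_borelField (W := W) hC
      haveI := hK₁
      ∀ x : ClassGroup (𝓞 K₁), x ^ p = 1 →
        (∀ (τ : absoluteGaloisGroup ℚ) (σ : K₁ ≃ₐ[ℚ] K₁) (a : ℕ),
          (∀ y : K₁, absRestrictNormalHom (W.borelField C) τ (y : W.borelField C) = ((σ y : K₁) : W.borelField C)) →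
          τ • P = a • P → ClassGroup.mulEquiv (AmbiguousClass.intAut σ) x = x ^ a) → x = 1) :
    haveI : NeZero p := ⟨(Fact.out : p.Prime).ne_zero⟩
    haveI := isGalois_borelField (W := W) hC
    haveI := hK₂
    ∀ μ : Additive (ClassGroup (𝓞 K₂)) →+ ZMod p,
      (∀ (τ : absoluteGaloisGroup ℚ) (σ : K₂ ≃ₐ[ℚ] K₂) (a : ℕ),
        (∀ x : K₂, absRestrictNormalHom (W.borelField C) τ (x : W.borelField C) = ((σ x : K₂) : W.borelField C)) →
        τ • P₂ - a • P₂ ∈ C →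
        ∀ (I J : (Ideal (𝓞 K₂))⁰),
          (J : Ideal (𝓞 K₂)) = (I : Ideal (𝓞 K₂)).map (AmbiguousClass.intAut σ : 𝓞 K₂ →+* 𝓞 K₂) →
          μ (Additive.ofMul (ClassGroup.mk0 J)) = a • μ (Additive.ofMul (ClassGroup.mk0 I))) →
      μ = 0 := by
  have hpr : p.Prime := Fact.out
  haveI : NeZero p := ⟨hpr.ne_zero⟩
  haveI := isGalois_borelField (W := W) hC
  haveI := hK₁
  have hp2' : 2 < p := lt_of_le_of_ne hpr.two_le (Ne.symm hp)
  haveI := hK₂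
  intro μ hμtest
  /- the Borel field `L = ℚ(χ₁, χ₂)`: number field, abelian over `ℚ`, `ζ_p ∈ L` with `det ρ̄ = ω`, totally complex, CM -/
  haveI : FiniteDimensional ℚ (W.borelField C) := finiteDimensional_borelField C
  haveI : NumberField (W.borelField C) := NumberField.mk
  have hV : Nat.card (W.geomTorsion (p : ℤ)) = p ^ 2 := W.natCard_geomTorsion_eq_sq_of_charZero hpr
  have hcard : Nat.card C = p := W.card_eq_of_ne_bot_of_ne_top hV h1 h2
  have hab : IsAbelianGalois ℚ ↥(W.borelField C) := isAbelianGalois_borelField (W := W) hC hcard hV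
  haveI := hab
  have hcommL := fun g σ => hab.toIsMulCommutative.is_comm.comm g σ
  haveI : IsAbelianGalois ℚ ↥K₁ := @IsAbelianGalois.tower_bot ℚ ↥K₁ ↥(W.borelField C) _ _ _ _ _ _ _ hab
  obtain ⟨ζ, hζ, hζact⟩ := W.exists_isPrimitiveRoot_borelField_smul_eq_pow C hC h1 h2 P hPC hP0 P₂ hP₂
  haveI : IsTotallyComplex ↥(W.borelField C) :=
    ReducibleFineSelmerImaginaryQuadraticThree.isTotallyComplex_of_isPrimitiveRoot hζ hp2'
  have hdeg : Module.finrank ℚ ↥(W.borelField C) ∣ (p - 1) ^ 2 := W.finrank_borelField_dvd hC h1 h2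
  have hpdeg : ¬ p ∣ (p - 1) ^ 2 := fun h => by
    have h1' := Nat.le_of_dvd (Nat.sub_pos_of_lt hpr.one_lt) (hpr.dvd_of_dvd_pow h)
    omega
  have hdvd_of : ∀ E : IntermediateField ℚ ↥(W.borelField C), ¬ p ∣ Module.finrank ↥E ↥(W.borelField C) := by
    intro E h
    exact hpdeg ((h.trans (Dvd.intro_left _ (Module.finrank_mul_finrank ℚ ↥E ↥(W.borelField C)))).trans hdeg)
  have hsurj := absRestrictNormalHom_surjective₅ (W.borelField C)
  choose lift hlift using hsurj
  have hsc₁ : ∀ τ : absoluteGaloisGroup ℚ, ∃ a : ℕ, τ • P = a • P := by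
    intro τ
    obtain ⟨a, ha'⟩ := exists_forall_smul_eq_zsmul_of_card_eq hC hcard τ
    obtain ⟨n, hn⟩ := exists_nsmul_eq_zsmul W P a
    exact ⟨n, by rw [ha' P hPC, ← hn, natCast_zsmul]⟩
  choose a₁ ha₁ using hsc₁
  have hsc₂ : ∀ τ : absoluteGaloisGroup ℚ, ∃ a : ℕ, τ • P₂ - a • P₂ ∈ C := by
    intro τ
    obtain ⟨a, ha'⟩ := exists_forall_smul_sub_zsmul_mem hC hcard hV τ
    obtain ⟨n, hn⟩ := exists_nsmul_eq_zsmul W P₂ a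
    exact ⟨n, by rw [← natCast_zsmul, hn]; exact ha' P₂⟩
  choose a₂ ha₂ using hsc₂
  have hA : ∀ σ (τ : absoluteGaloisGroup ℚ),
      absRestrictNormalHom (W.borelField C) τ = σ → a₁ (lift σ) ≡ a₁ τ [MOD p] ∧ a₂ (lift σ) ≡ a₂ τ [MOD p] := by
    intro σ τ hτ
    obtain ⟨hCeq, hVeq⟩ := smul_eq_smul_of_absRestrictNormalHom_eq W C hC (lift σ) τ (by rw [hlift, hτ])
    refine ⟨modEq_of_nsmul_eq_nsmul W hP0 (by rw [← ha₁, ← ha₁, hCeq P hPC]), modEq_of_nsmul_sub_nsmul_mem W C hP₂ ?_⟩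
    have e : a₂ (lift σ) • P₂ - a₂ τ • P₂ =
        -((lift σ) • P₂ - a₂ (lift σ) • P₂) + ((lift σ) • P₂ - τ • P₂) + (τ • P₂ - a₂ τ • P₂) := by abel
    rw [e]
    exact C.add_mem (C.add_mem (C.neg_mem (ha₂ _)) (hVeq P₂)) (ha₂ τ)
  let a := fun σ => a₁ (lift σ)
  let ψ := fun σ => a₂ (lift σ)
  let ω := fun σ => a₁ (lift σ) * a₂ (lift σ)
  have haψ : ∀ σ, ω σ = a σ * ψ σ := fun σ => rfl
  have hω : ∀ σ, σ ζ = ζ ^ ω σ := by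
    intro σ
    have h := hζact (lift σ) (a₁ (lift σ)) (a₂ (lift σ)) (ha₁ _) (ha₂ _)
    rw [hlift] at h
    exact h
  let c₀ := absRestrictNormalHom (W.borelField C) τ₀
  have hc₀ : ∀ x, c₀ x = IsCMField.complexConj ↥(W.borelField C) x := by
    obtain ⟨φ, hφ⟩ := hτ₀
    intro x
    apply φ.injective
    rw [IsCMField.complexEmbedding_complexConj]
    exact hφ x
  have hc₀inv : c₀⁻¹ = c₀ := by
    rw [inv_eq_iff_mul_eq_one]
    refine AlgEquiv.ext fun x => ?_
    rw [AlgEquiv.mul_apply, hc₀, hc₀, AlgEquiv.one_apply]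
    exact IsCMField.complexConj_apply_apply _ x
  have hac₀ : a c₀ ≡ p - 1 [MOD p] :=
    ((hA c₀ τ₀ rfl).1).trans (modEq_of_nsmul_eq_nsmul W hP0 (by rw [← ha₁, hτP]))
  have hωc₀ : ω c₀ ≡ p - 1 [MOD p] := IsCMField.modEq_sub_one_of_complexConj ℚ ↥(W.borelField C) hpr hζ ω hω c₀ hc₀
  have hψc₀ : ψ c₀ ≡ 1 [MOD p] :=
    IsCMField.modEq_one_of_mul_of_complexConj ℚ ↥(W.borelField C) hpr hζ a ψ ω hω haψ c₀ hc₀ hac₀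
  have hP₂0 : P₂ ≠ 0 := fun h => hP₂ (h ▸ C.zero_mem)
  have hψ : ∃ σ, ¬ ψ σ ≡ 1 [MOD p] := by
    obtain ⟨τ, hτ⟩ := hne₂
    refine ⟨absRestrictNormalHom (W.borelField C) τ, fun h => hτ ?_⟩
    have h3 : a₂ τ ≡ 1 [MOD p] := ((hA _ τ rfl).2).symm.trans h
    have h4 : a₂ τ • P₂ = (1 : ℕ) • P₂ := by
      have hpP : p • P₂ = 0 := Subtype.ext (by
        rw [AddSubmonoidClass.coe_nsmul, ZeroMemClass.coe_zero]; exact AddSubgroup.torsionBy.nsmul_iff.mp P₂.2)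
      rw [nsmul_eq_nsmul_iff_modEq, addOrderOf_eq_prime hpP hP₂0]
      exact h3
    have h5 := ha₂ τ
    rwa [h4, one_smul] at h5
  -- `a₂(lift σ) · a₂(lift σ⁻¹) ≡ 1`
  have ha₂inv : ∀ σ, a₂ (lift σ) * a₂ (lift σ⁻¹) ≡ 1 [MOD p] := by
    intro σ
    apply modEq_of_nsmul_sub_nsmul_mem W C hP₂
    have e3 := (smul_eq_smul_of_absRestrictNormalHom_eq W C hC (lift σ * lift σ⁻¹) 1
      (by rw [map_mul, hlift, hlift, map_one, mul_inv_cancel])).2 P₂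
    have e4 : (lift σ * lift σ⁻¹) • P₂ - (a₂ (lift σ) * a₂ (lift σ⁻¹)) • P₂ =
        lift σ • (lift σ⁻¹ • P₂ - a₂ (lift σ⁻¹) • P₂) + a₂ (lift σ⁻¹) • (lift σ • P₂ - a₂ (lift σ) • P₂) := by
      rw [mul_smul, smul_sub, smul_nsmul_geomTorsion, smul_sub, smul_smul (a₂ (lift σ⁻¹)) (a₂ (lift σ)) P₂,
        mul_comm (a₂ (lift σ⁻¹)) (a₂ (lift σ)), sub_add_sub_cancel]
    have e5 : (lift σ * lift σ⁻¹) • P₂ - (a₂ (lift σ) * a₂ (lift σ⁻¹)) • P₂ ∈ C := by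
      rw [e4]; exact C.add_mem (hC _ _ (ha₂ _)) (C.nsmul_mem (ha₂ _) _)
    have e6 : (a₂ (lift σ) * a₂ (lift σ⁻¹)) • P₂ - (1 : ℕ) • P₂ =
        -((lift σ * lift σ⁻¹) • P₂ - (a₂ (lift σ) * a₂ (lift σ⁻¹)) • P₂) + ((lift σ * lift σ⁻¹) • P₂ - (1 : absoluteGaloisGroup ℚ) • P₂) := by
      rw [one_smul, one_smul]; abel
    rw [e6]
    exact C.add_mem (C.neg_mem e5) e3
  -- on `Gal(L/K₁)` the exponent `ω ψ⁻¹ = χ₁` is trivial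
  have hfix : ∀ h : ↥(W.borelField C) ≃ₐ[↥K₁] ↥(W.borelField C),
      ω (h.restrictScalars ℚ) * ψ (h.restrictScalars ℚ)⁻¹ ≡ 1 [MOD p] := by
    intro h
    have e1 : a₁ (lift (h.restrictScalars ℚ)) ≡ 1 [MOD p] := by
      refine modEq_of_nsmul_eq_nsmul W hP0 ?_
      rw [← ha₁, one_smul]
      refine hK₁P _ fun x => ?_
      rw [hlift]
      exact h.commutes x
    have e7 := e1.mul (ha₂inv (h.restrictScalars ℚ))
    rw [one_mul] at e7
    calc ω (h.restrictScalars ℚ) * ψ (h.restrictScalars ℚ)⁻¹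
        = a₁ (lift (h.restrictScalars ℚ)) * (a₂ (lift (h.restrictScalars ℚ)) * a₂ (lift (h.restrictScalars ℚ)⁻¹)) :=
          mul_assoc _ _ _
      _ ≡ 1 [MOD p] := e7
  /- the odd side: the eigenclass test on `K₁` in the reflection theorem's currency -/
  have hkill : ∀ x : ClassGroup (𝓞 ↥K₁), x ^ p = 1 →
      (∀ σ (σK : ↥K₁ ≃ₐ[ℚ] ↥K₁), (∀ y : ↥K₁, σ (algebraMap ↥K₁ ↥(W.borelField C) y) = algebraMap ↥K₁ ↥(W.borelField C) (σK y)) →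
        ClassGroup.mulEquiv (AmbiguousClass.intAut σK) x = x ^ (ω σ * ψ σ⁻¹)) → x = 1 := by
    intro x hxp H
    refine hkill₁ x hxp fun τ σK a hcompat hτa => ?_
    have hm := H (absRestrictNormalHom (W.borelField C) τ) σK fun y => hcompat y
    have e1 : a₁ (lift (absRestrictNormalHom (W.borelField C) τ)) ≡ a [MOD p] :=
      (hA _ τ rfl).1.trans (modEq_of_nsmul_eq_nsmul W hP0 (by rw [← ha₁, hτa]))
    have e2 := ha₂inv (absRestrictNormalHom (W.borelField C) τ)
    have e3 : ω (absRestrictNormalHom (W.borelField C) τ) * ψ (absRestrictNormalHom (W.borelField C) τ)⁻¹ ≡ a * 1 [MOD p] := by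
      calc ω (absRestrictNormalHom (W.borelField C) τ) * ψ (absRestrictNormalHom (W.borelField C) τ)⁻¹
          = a₁ (lift (absRestrictNormalHom (W.borelField C) τ)) *
              (a₂ (lift (absRestrictNormalHom (W.borelField C) τ)) * a₂ (lift (absRestrictNormalHom (W.borelField C) τ)⁻¹)) :=
            mul_assoc _ _ _
        _ ≡ a * 1 [MOD p] := e1.mul e2
    rw [mul_one] at e3
    rw [hm]
    obtain hx1 | hx1 := eq_or_ne x 1
    · rw [hx1, one_pow, one_pow]
    · rw [pow_eq_pow_iff_modEq, orderOf_eq_prime hxp hx1]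
      exact e3
  /- the even side: `Gal(L/ℚ)` restricts to `K₂` (abelian: every subfield is stable) and `μ` is a `ψ`-eigenfunctional -/
  have hμ : ∀ σ, ∃ σK : ↥K₂ ≃ₐ[ℚ] ↥K₂,
      (∀ y : ↥K₂, σ (algebraMap ↥K₂ ↥(W.borelField C) y) = algebraMap ↥K₂ ↥(W.borelField C) (σK y)) ∧
      ∀ d : ClassGroup (𝓞 ↥K₂),
        μ (Additive.ofMul (ClassGroup.mulEquiv (AmbiguousClass.intAut σK) d)) = (ψ σ : ZMod p) * μ (Additive.ofMul d) := by
    intro σ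
    obtain ⟨σK, hσK⟩ := exists_algEquiv_restrict_of_forall_mem (K := ℚ) K₂ σ
      (fun y hy => algEquiv_mem_of_isMulCommutative (K := ℚ) hcommL K₂ σ y hy)
      (fun y hy => algEquiv_mem_of_isMulCommutative (K := ℚ) hcommL K₂ σ.symm y hy)
    refine ⟨σK, fun y => (hσK y).symm, fun d => ?_⟩
    obtain ⟨I, rfl⟩ := ClassGroup.mk0_surjective d
    have key := hμtest (lift σ) σK (a₂ (lift σ)) (fun x => by rw [hlift]; exact (hσK x).symm) (ha₂ _) I
      ⟨_, AmbiguousClass.map_mem_nonZeroDivisors σK I⟩ rfl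
    exact (congrArg (fun c => μ (Additive.ofMul c)) (AmbiguousClass.mulEquiv_mk0 σK I)).trans
      (key.trans (nsmul_eq_mul _ _))
  exact IsCMField.eigenHom_eq_zero_of_reflection_of_eigenClass_test ℚ ↥(W.borelField C) hpr hp hζ ψ ω hω c₀ hc₀ hψc₀ hψ
    ↥K₂ (hdvd_of K₂) ↥K₁ (hdvd_of K₁) hfix hkill μ hμ

end Door

end Summit.BirchSwinnertonDyer.BirchSwinnertonDyer.Theorems.ReducibleFineSelmerReflection

end
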